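import Summits.BirchSwinnertonDyer.BirchSwinnertonDyer.Theses.SignedBaseChange
import Summits.BirchSwinnertonDyer.BirchSwinnertonDyer.Theses.SignedLowerHalves
import HarnessLib

/-!
# «acns» — typability sketch for the small-image twins of SignedBaseChange's acanchor cruxes
# (crux idea `heegner-primitivity-prime-to-p-image`, NOTE g3 N3; item stmt-BirchSwinnertonDyer-19002)

Ideator bsd-idea-13 g3 (planner-bsd-idea-13-g3-0, 2026-08-28). NOTHING is asserted and NO line is registered:
this file only shows that the statements T1/T2/T3 of the designed line «acns» ELABORATE today, verbatim the
texts of `SignedBaseChange.AnticyclotomicEisensteinDivisibility` (stmt-20727),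
`SignedBaseChange.TwoVariableEulerSystemDivisibility` (stmt-20728) and
`SignedBaseChange.TwistPairGreenbergProductDivisibilityCanonical` (K1″) with the single binder swap
`Rank1Residual.Surj W p →` ↦ `Rank1Residual.ClassX7 W p → ¬ W.HasCM → W.frobeniusTrace p = 0 → ¬ Rank1Residual.Surj W p →`
(the domain of the shared crux `KobayashiMainConjectureSmallImage` at `5 ≤ p`). The two sanity lemmas at the
end record (i) that the swap is the ONLY change (the Surj versions and the small-image versions have the
same shape: both are specialisations of one image-parametrised statement `AcDivAt P` / `ES2At P`), and (ii) the
trivial monotonicity in the image predicate. No new definitions of mathematical objects; no `sorry`.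
-/

-- D-0017: single-problem summit, the namespace repeats the problem name by design.
set_option linter.dupNamespace false
set_option autoImplicit false

noncomputable section

namespace Summit.BirchSwinnertonDyer.BirchSwinnertonDyer.Cruxes.KobayashiMainConjectureSmallImage.Acns

open scoped BigOperators Topology Manifold Classical MeasureTheory ProbabilityTheory Matrix InnerProductSpace ComplexConjugate ContinuousMap
open Filter Set Function TopologicalSpace MeasureTheory
open Literature
open Summit.BirchSwinnertonDyer.BirchSwinnertonDyer.Theses.SignedBaseChange

/-- T1 of «acns»: the text of `SignedBaseChange.AnticyclotomicEisensteinDivisibility` (stmt-20727) with the image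
binder swapped to the small-image X7 branch. Typability only; nothing asserted. -/
def AcDivNs : Prop :=
  (Literature.NumberTheory.EllipticCurves.BurungaleCastellaSkinner2025.prop422_greenbergAnyRoot_hasUnitContent_minus ∧ Literature.NumberTheory.EllipticCurves.BurungaleSkinnerTianWan2024.props118_27_519_exists_signedTwoVariablePackage_supersingular_PRE) → Literature.NumberTheory.EllipticCurves.ModularForms.nonempty_modularParametrizationData → ∀ (W : WeierstrassCurve ℚ) [W.IsElliptic] [W.IsGloballyMinimal] (p : ℕ) [Fact p.Prime], 5 ≤ p → W.HasGoodReductionAtPrime p → Literature.NumberTheory.EllipticCurves.Rank1Residual.ClassX7 W p → ¬ W.HasCM → W.frobeniusTrace p = 0 → ¬ Literature.NumberTheory.EllipticCurves.Rank1Residual.Surj W p → ∀ (K : Type) [Field K] [NumberField K] (ι : PadicAlgCl p ≃+* ℂ) (v vbar : IsDedekindDomain.HeightOneSpectrum (NumberField.RingOfIntegers K)) (κ₁ κ₂ : Literature.NumberTheory.EllipticCurves.ZpExtension K p) (γ₁ γ₂ : Field.absoluteGaloisGroup K) [Fact (Literature.NumberTheory.EllipticCurves.ZpExtension.IsTopGeneratorPair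 κ₁ κ₂ γ₁ γ₂)] [NeZero (NumberField.discr K).natAbs] (N : ℕ) [NeZero N] (f : CuspForm (CongruenceSubgroup.Gamma0 N) 2), Literature.NumberTheory.EllipticCurves.ModularForms.IsNewformOf W f → (N : ℤ) = W.conductorNorm ℤ → Literature.NumberTheory.EllipticCurves.IsImaginaryQuadratic K → ((Ideal.span {(p : ℤ)}).primesOver (NumberField.RingOfIntegers K)).ncard = 2 → ((p : ℕ) : NumberField.RingOfIntegers K) ∈ v.asIdeal → ((p : ℕ) : NumberField.RingOfIntegers K) ∈ vbar.asIdeal → vbar ≠ v → (∀ (w : NumberField.InfinitePlace K) (k : NumberField.RingOfIntegers K), k ∈ v.asIdeal ↔ ‖ι.symm (w.embedding (k : K))‖ < 1) → IsCoprime (N : ℤ) (NumberField.discr K) → (∀ ℓ : ℕ, ℓ.Prime → ℓ ∣ N → ((Ideal.span {(ℓ : ℤ)}).primesOver (NumberField.RingOfIntegers K)).ncard = 2) → Odd (NumberField.discr K) → NumberField.discr K ≠ -3 → κ₁.IsCyclotomic → κ₂.IsAnticyclotomic → ∀ (Ω δ : ℂ) (Ωp : (Literature.NumberTheory.EllipticCurves.unrIntegers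 p)ˣ) (LK G : PowerSeries (PowerSeries (PadicComplexInt p))), Ω ≠ 0 → (δ ^ 2 = (NumberField.discr K : ℂ) ∨ δ ^ 2 = -(NumberField.discr K : ℂ)) → Literature.NumberTheory.EllipticCurves.IsKatzMeasure₂ ι v vbar ∅ κ₁ κ₂ γ₁⁻¹ γ₂⁻¹ 1 Ω δ ((Ωp : Literature.NumberTheory.EllipticCurves.unrIntegers p) : PadicComplex p) LK → Literature.NumberTheory.EllipticCurves.IsGreenbergLFunctionAnyRoot₂ ι v vbar κ₁ κ₂ γ₁⁻¹ γ₂⁻¹ f (NumberField.discr K).natAbs (NumberField.classNumber K) LK G → ∀ J : ℤ_[p] →+* PadicComplexInt p, (∀ x : ℤ_[p], ((J x : PadicComplexInt p) : PadicComplex p) = ((x : ℚ_[p]) : PadicComplex p)) → ((WeierstrassCurve.XGr₂.charIdeal (W.baseChange K) p κ₁ κ₂ vbar γ₁ γ₂).map (Literature.NumberTheory.EllipticCurves.IwasawaAlgebra₂.toUnr₂ p J)).map (PowerSeries.constantCoeff (R := PowerSeries (PadicComplexInt p))) ≤ Ideal.span {Literature.NumberTheory.EllipticCurves.UnrSeries₂.minus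 G}

/-- T2 of «acns»: the text of `SignedBaseChange.TwoVariableEulerSystemDivisibility` (stmt-20728) with the image binder
swapped to the small-image X7 branch. Typability only; nothing asserted. -/
def ES2Ns : Prop :=
  (Literature.NumberTheory.EllipticCurves.BurungaleCastellaSkinner2025.prop422_greenbergAnyRoot_hasUnitContent_minus ∧ Literature.NumberTheory.EllipticCurves.BurungaleSkinnerTianWan2024.props118_27_519_exists_signedTwoVariablePackage_supersingular_PRE) → Literature.NumberTheory.EllipticCurves.ModularForms.nonempty_modularParametrizationData → ∀ (W : WeierstrassCurve ℚ) [W.IsElliptic] [W.IsGloballyMinimal] (p : ℕ) [Fact p.Prime], 5 ≤ p → W.HasGoodReductionAtPrime p → Literature.NumberTheory.EllipticCurves.Rank1Residual.ClassX7 W p → ¬ W.HasCM → W.frobeniusTrace p = 0 → ¬ Literature.NumberTheory.EllipticCurves.Rank1Residual.Surj W p → ∀ (K : Type) [Field K] [NumberField K] (ι : PadicAlgCl p ≃+* ℂ) (v vbar : IsDedekindDomain.HeightOneSpectrum (NumberField.RingOfIntegers K)) (κ₁ κ₂ : Literature.NumberTheory.EllipticCurves.ZpExtension K p) (γ₁ γ₂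 : Field.absoluteGaloisGroup K) [Fact (Literature.NumberTheory.EllipticCurves.ZpExtension.IsTopGeneratorPair κ₁ κ₂ γ₁ γ₂)] [NeZero (NumberField.discr K).natAbs] (N : ℕ) [NeZero N] (f : CuspForm (CongruenceSubgroup.Gamma0 N) 2), Literature.NumberTheory.EllipticCurves.ModularForms.IsNewformOf W f → (N : ℤ) = W.conductorNorm ℤ → Literature.NumberTheory.EllipticCurves.IsImaginaryQuadratic K → ((Ideal.span {(p : ℤ)}).primesOver (NumberField.RingOfIntegers K)).ncard = 2 → ((p : ℕ) : NumberField.RingOfIntegers K) ∈ v.asIdeal → ((p : ℕ) : NumberField.RingOfIntegers K) ∈ vbar.asIdeal → vbar ≠ v → (∀ (w : NumberField.InfinitePlace K) (k : NumberField.RingOfIntegers K), k ∈ v.asIdeal ↔ ‖ι.symm (w.embedding (k : K))‖ < 1) → IsCoprime (N : ℤ) (NumberField.discr K) → (∀ ℓ : ℕ, ℓ.Prime → ℓ ∣ N → ((Ideal.span {(ℓ : ℤ)}).primesOver (NumberField.RingOfIntegers K)).ncard = 2) → Odd (NumberField.discr K) → NumberField.discr K ≠ -3 → κ₁.IsCyclotomic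 → κ₂.IsAnticyclotomic → ∀ (Ω δ : ℂ) (Ωp : (Literature.NumberTheory.EllipticCurves.unrIntegers p)ˣ) (LK G : PowerSeries (PowerSeries (PadicComplexInt p))), Ω ≠ 0 → (δ ^ 2 = (NumberField.discr K : ℂ) ∨ δ ^ 2 = -(NumberField.discr K : ℂ)) → Literature.NumberTheory.EllipticCurves.IsKatzMeasure₂ ι v vbar ∅ κ₁ κ₂ γ₁⁻¹ γ₂⁻¹ 1 Ω δ ((Ωp : Literature.NumberTheory.EllipticCurves.unrIntegers p) : PadicComplex p) LK → Literature.NumberTheory.EllipticCurves.IsGreenbergLFunctionAnyRoot₂ ι v vbar κ₁ κ₂ γ₁⁻¹ γ₂⁻¹ f (NumberField.discr K).natAbs (NumberField.classNumber K) LK G → ∀ J : ℤ_[p] →+* PadicComplexInt p, (∀ x : ℤ_[p], ((J x : PadicComplexInt p) : PadicComplex p) = ((x : ℚ_[p]) : PadicComplex p)) → Ideal.span {G} ≤ (WeierstrassCurve.XGr₂.charIdeal (W.baseChange K) p κ₁ κ₂ vbar γ₁ γ₂).map (Literature.NumberTheory.EllipticCurves.IwasawaAlgebra₂.toUnr₂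 p J)

/-- T3 of «acns»: the text of `SignedBaseChange.TwistPairGreenbergProductDivisibilityCanonical` (K1″) with the image binder
swapped to the small-image X7 branch (K1″ already carries `ClassX7 W p`). Typability only; nothing asserted. -/
def CanonicalNs : Prop :=
  SignedTwoVariableInputs → Literature.NumberTheory.EllipticCurves.ModularForms.nonempty_modularParametrizationData → ∀ (W : WeierstrassCurve ℚ) [W.IsElliptic] [W.IsGloballyMinimal] (p : ℕ) [Fact p.Prime], 5 ≤ p → Literature.NumberTheory.EllipticCurves.Rank1Residual.ClassX7 W p → ¬ W.HasCM → W.frobeniusTrace p = 0 → ¬ Literature.NumberTheory.EllipticCurves.Rank1Residual.Surj W p → ∃ (K : Type) (_ : Field K) (_ : NumberField K) (ι : PadicAlgCl p ≃+* ℂ) (v vbar : IsDedekindDomain.HeightOneSpectrum (NumberField.RingOfIntegers K)) (κ₁ κ₂ : Literature.NumberTheory.EllipticCurves.ZpExtension K p) (γ₁ γ₂ : Field.absoluteGaloisGroup K) (_ : Fact (Literature.NumberTheory.EllipticCurves.ZpExtension.IsTopGeneratorPair κ₁ κ₂ γ₁ γ₂)) (_ : NeZero (NumberField.discr K).natAbs)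 (N : ℕ) (_ : NeZero N) (f : CuspForm (CongruenceSubgroup.Gamma0 N) 2) (d : ℤ) (W' : WeierstrassCurve ℚ) (_ : W'.IsElliptic) (_ : W'.IsGloballyMinimal) (C : WeierstrassCurve.VariableChange ℚ) (N' : ℕ) (_ : NeZero N') (f' : CuspForm (CongruenceSubgroup.Gamma0 N') 2), Literature.NumberTheory.EllipticCurves.ModularForms.IsNewformOf W f ∧ (N : ℤ) = W.conductorNorm ℤ ∧ Literature.NumberTheory.EllipticCurves.ModularForms.IsNewformOf W' f' ∧ (N' : ℤ) = W'.conductorNorm ℤ ∧ Squarefree d ∧ 1 < d ∧ (∀ q : ℕ, q.Prime → Literature.NumberTheory.EllipticCurves.BurungaleSkinnerTianWan2024.RamifiedInQuadratic d q → q ≠ p ∧ ¬ q ∣ N ∧ ¬ (q : ℤ) ∣ NumberField.discr K) ∧ C • W' = W.quadraticTwist (d : ℚ) ∧ Literature.NumberTheory.EllipticCurves.IsImaginaryQuadratic K ∧ ((Ideal.span {(p : ℤ)}).primesOver (NumberField.RingOfIntegers K)).ncard = 2 ∧ ((p : ℕ) : NumberField.RingOfIntegers K) ∈ v.asIdeal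 ∧ ((p : ℕ) : NumberField.RingOfIntegers K) ∈ vbar.asIdeal ∧ vbar ≠ v ∧ (∀ (w : NumberField.InfinitePlace K) (k : NumberField.RingOfIntegers K), k ∈ v.asIdeal ↔ ‖ι.symm (w.embedding (k : K))‖ < 1) ∧ IsCoprime (N : ℤ) (NumberField.discr K) ∧ (∀ ℓ : ℕ, ℓ.Prime → ℓ ∣ N → ((Ideal.span {(ℓ : ℤ)}).primesOver (NumberField.RingOfIntegers K)).ncard = 2) ∧ (∀ ℓ : ℕ, ℓ.Prime → (ℓ : ℤ) ∣ d → ((Ideal.span {(ℓ : ℤ)}).primesOver (NumberField.RingOfIntegers K)).ncard = 2) ∧ ((Ideal.span {(2 : ℤ)}).primesOver (NumberField.RingOfIntegers K)).ncard = 2 ∧ (∀ ρ : Literature.NumberTheory.GaloisRepresentations.ModPGaloisRep K (ZMod p) 2, (W.baseChange K).IsTorsionGaloisRep p ρ → Literature.NumberTheory.GaloisRepresentations.FramedRep.IsAbsolutelyIrreducible ρ) ∧ κ₁.IsCyclotomic ∧ κ₂.IsAnticyclotomic ∧ (∃ ζ : ℤ_[p]ˣ, IsOfFinOrder ζ ∧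 ((Literature.NumberTheory.GaloisRepresentations.GaloisRep.cyclotomicCharacter K p γ₁ * ζ : ℤ_[p]ˣ) : ℤ_[p]) = (Literature.NumberTheory.EllipticCurves.cyclotomicGenerator p : ℤ_[p])) ∧ ∀ (Ω δ : ℂ) (Ωp : (Literature.NumberTheory.EllipticCurves.unrIntegers p)ˣ) (LK G G' : PowerSeries (PowerSeries (PadicComplexInt p))), Ω ≠ 0 → (δ ^ 2 = (NumberField.discr K : ℂ) ∨ δ ^ 2 = -(NumberField.discr K : ℂ)) → Literature.NumberTheory.EllipticCurves.IsKatzMeasure₂ ι v vbar ∅ κ₁ κ₂ γ₁⁻¹ γ₂⁻¹ 1 Ω δ ((Ωp : Literature.NumberTheory.EllipticCurves.unrIntegers p) : PadicComplex p) LK → Literature.NumberTheory.EllipticCurves.IsGreenbergLFunctionAnyRoot₂ ι v vbar κ₁ κ₂ γ₁⁻¹ γ₂⁻¹ f (NumberField.discr K).natAbs (NumberField.classNumber K) LK G → Literature.NumberTheory.EllipticCurves.IsGreenbergLFunctionAnyRoot₂ ι v vbar κ₁ κ₂ γ₁⁻¹ γ₂⁻¹ f' (NumberField.discr K).natAbs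 (NumberField.classNumber K) LK G' → ∀ J : ℤ_[p] →+* PadicComplexInt p, (∀ x : ℤ_[p], ((J x : PadicComplexInt p) : PadicComplex p) = ((x : ℚ_[p]) : PadicComplex p)) → ∃ s : PowerSeries (PadicComplexInt p), s ≠ 0 ∧ Ideal.span {PowerSeries.map (PowerSeries.C (R := PadicComplexInt p)) s} * ((WeierstrassCurve.XGr₂.charIdeal (W.baseChange K) p κ₁ κ₂ vbar γ₁ γ₂).map (Literature.NumberTheory.EllipticCurves.IwasawaAlgebra₂.toUnr₂ p J) * (WeierstrassCurve.XGr₂.charIdeal (W'.baseChange K) p κ₁ κ₂ vbar γ₁ γ₂).map (Literature.NumberTheory.EllipticCurves.IwasawaAlgebra₂.toUnr₂ p J)) ≤ Ideal.span {G * G'}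

/-- Sanity: the three statements are propositions over existing declarations (elaboration is the content of this file). -/
example : (AcDivNs → ES2Ns → CanonicalNs → True) := fun _ _ _ ↦ trivial

end Summit.BirchSwinnertonDyer.BirchSwinnertonDyer.Cruxes.KobayashiMainConjectureSmallImage.Acns

end
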